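import Summits.Ventures.CertifiedManyBodySolver.Observables.PairBoxCeilingSharpness
import Summits.Ventures.CertifiedManyBodySolver.Observables.BraggWeightTailCeilingQ
import HarnessLib

/-!
# Footprint-limited ceilings at EVERY wavevector: the `1/M^d` law of range-`M` two-point data holds at the Néel
# point and on the stripe stars exactly as at `Q = 0`

HONEST FRAMING: first certified bounds on pairing observables; not a superconductivity verdict; every number certified
(two lineages + referee) or labelled float.  Cell hubbard-obs (D-0042 crew 1), seat hubbard-obs-p3 (CONTROLS), gen 2.
Pure harmonic analysis; zero compute; NO definition, no named fact, no `sorry`.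

`PairBoxCeilingSharpness.lean` (p1, lead d96/(ao1)): every ceiling functional `Φ` on lattice functions that is SOUND for the
Bragg weight at `Q = 0` and RANGE-`M` LOCAL (depends only on `C` on `‖r‖∞ < M`) satisfies `Φ C ≥ (C(0)/M^d)`-class on some
`C` with NO weight at `0`.  The controls seat reads Néel (`Q = (π,π)`) and stripe-arm ceilings from the same kind of data
(`BoxRowBraggCeilings`, `DiamondKernelNeelCeiling`); this file transfers the obstruction to ANY wavevector by MODULATION:

* `represents_phase_of_map_add`: if `μ` represents `C` then its translate by `+Q` represents `r ↦ e^{+i r·Q} C(r)`;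
  `braggWeight_map_add`: the translate's Bragg weight at `Q` is `μ`'s at `0` (twin of `braggWeight_map_sub_zero`).
* **`exists_noBragg_witness_of_boxLocal_ceiling_at`** (`d ≥ 1`, `M ≥ 1`, any `Q ∈ ℝᵈ`): for every `Φ` that is SOUND AT `Q`
  (`braggWeight μ ![Q] ≤ Φ C` whenever `μ` represents `C`) and range-`M` local, there is a represented `C` with
  `braggWeight = 0` at `Q`, `C 0 = M^{-d}`, and `Φ C ≥ (M^{-d})²` — i.e. `Φ C ≥ C(0)/M^d` on data whose true order at `Q` is
  ZERO.  So a Néel-weight (or stripe) ceiling computed from `3 × 3` / `4 × 3` / EXT5-class footprints cannot go below the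
  `C_s(0)/|B|`-class floor whatever the level or the energy window (TARGET §10 (10b): for the doped anchor
  `C_s(0) = ¾(7/8 − 2·docc) ≈ 0.6`, so `≈ 0.07` at `3 × 3`, and the AF-coherent short-range sum sits well above that);
  «how far from Néel» at print precision needs the tail input of `BraggWeightTailCeilingQ.lean`, and no finite-footprint
  data give a floor (`BraggWeightNoFloor.lean`).

References: Katznelson, *An Introduction to Harmonic Analysis* (2004) I.7; Scalapino, Phys. Rep. 250 (1995) 329, §2.
-/

noncomputable section

open MeasureTheory Complex Filter Topology
open scoped Real BigOperators

namespace Summit.Ventures.CertifiedManyBodySolver.Observables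

variable {d : ℕ} {C : (Fin d → ℤ) → ℂ} (μ : Measure (EuclideanSpace ℝ (Fin d)))

/-- Translation by `+Q` is measurable. -/
private theorem measurable_add_toLp (Q : Fin d → ℝ) :
    Measurable (fun ξ : EuclideanSpace ℝ (Fin d) => ξ + WithLp.toLp 2 Q) :=
  measurable_id.add_const _

/-- **The `+Q` translate represents the modulated function**: `∫ e^{i r·ξ} d(μ ∘ (· − Q)) = e^{+i r·Q} C(r)`.
[cite: Katznelson2004, I.7] -/
theorem represents_phase_of_map_add
    (hμ : ∀ r : Fin d → ℤ, ∫ ξ, exp ((∑ i, (r i : ℝ) * ξ i : ℝ) * I) ∂μ = C r) (Q : Fin d → ℝ) (r : Fin d → ℤ) :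
    ∫ ξ, exp ((∑ i, (r i : ℝ) * ξ i : ℝ) * I) ∂(μ.map (fun ξ => ξ + WithLp.toLp 2 Q)) =
      exp ((((∑ i, (r i : ℝ) * Q i : ℝ)) : ℂ) * I) * C r := by
  rw [integral_map (measurable_add_toLp Q).aemeasurable]
  · have h : (fun ξ : EuclideanSpace ℝ (Fin d) => exp ((∑ i, (r i : ℝ) * (ξ + WithLp.toLp 2 Q) i : ℝ) * I))
        = fun ξ => exp ((∑ i, (r i : ℝ) * ξ i : ℝ) * I) * exp ((((∑ i, (r i : ℝ) * Q i : ℝ)) : ℂ) * I) := by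
      funext ξ
      rw [← Complex.exp_add]
      congr 1
      have : (∑ i, (r i : ℝ) * (ξ + WithLp.toLp 2 Q) i : ℝ) = (∑ i, (r i : ℝ) * ξ i) + ∑ i, (r i : ℝ) * Q i := by
        rw [← Finset.sum_add_distrib]
        exact Finset.sum_congr rfl fun i _ => by rw [WithLp.ofLp_add, WithLp.ofLp_toLp, Pi.add_apply]; ring
      rw [this]; push_cast; ring
    rw [h, integral_mul_const, hμ r, mul_comm]
  · exact (Complex.continuous_exp.comp ((Complex.continuous_ofReal.comp (by fun_prop)).mul
      continuous_const)).aestronglyMeasurable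

/-- **The `+Q` translate carries the weight at `0` to `Q`**: `braggWeight (μ ∘ (· − Q)) ![Q] = braggWeight μ ![0]`.
[cite: Katznelson2004, I.7] -/
theorem braggWeight_map_add (Q : Fin d → ℝ) :
    braggWeight (μ.map (fun ξ => ξ + WithLp.toLp 2 Q)) ![Q] = braggWeight μ ![(0 : Fin d → ℝ)] := by
  rw [braggWeight_single, braggWeight_single, Measure.real, Measure.real,
    Measure.map_apply (measurable_add_toLp Q) (measurableSet_braggSet _)]
  congr 2
  ext ξ
  simp only [Set.mem_preimage, braggSet, Set.mem_setOf_eq, WithLp.ofLp_add, Pi.add_apply,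
    Pi.zero_apply, zero_add]
  exact ⟨fun ⟨m, hm⟩ => ⟨m, fun i => by linarith [hm i]⟩, fun ⟨m, hm⟩ => ⟨m, fun i => by linarith [hm i]⟩⟩

/-- **Range-`M` ceilings are footprint-limited at EVERY wavevector.**  Let `d ≥ 1`, `M ≥ 1`, `Q ∈ ℝᵈ`, and let `Φ` be a
functional on lattice functions that is SOUND AT `Q` (`braggWeight μ ![Q] ≤ Φ C` whenever the finite measure `μ` represents
`C`) and RANGE-`M` LOCAL (`Φ C = Φ C'` whenever `C = C'` on `‖r‖∞ < M`).  Then there is a represented lattice function `C`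
whose Bragg weight at `Q` VANISHES, with `C 0 = M^{-d}` and `Φ C ≥ (M^{-d})² = C(0)/M^d`.  (p1's `Q = 0` witnesses modulated by
`e^{i r·Q}`: modulation preserves the data on the box and moves the Bragg peak from `0` to `Q`.) [cite: Katznelson2004, I.7] -/
theorem exists_noBragg_witness_of_boxLocal_ceiling_at (M : ℕ) [NeZero M] (hd : 1 ≤ d) (Q : Fin d → ℝ)
    (Φ : ((Fin d → ℤ) → ℂ) → ℝ)
    (hsound : ∀ (μ : Measure (EuclideanSpace ℝ (Fin d))) [IsFiniteMeasure μ] (C : (Fin d → ℤ) → ℂ),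
      (∀ r : Fin d → ℤ, ∫ ξ, exp ((∑ i, (r i : ℝ) * ξ i : ℝ) * I) ∂μ = C r) → braggWeight μ ![Q] ≤ Φ C)
    (hlocal : ∀ C C' : (Fin d → ℤ) → ℂ, (∀ r : Fin d → ℤ, (∀ i, |r i| < M) → C r = C' r) → Φ C = Φ C') :
    ∃ (μ : Measure (EuclideanSpace ℝ (Fin d))) (_ : IsFiniteMeasure μ) (C : (Fin d → ℤ) → ℂ),
      (∀ r : Fin d → ℤ, ∫ ξ, exp ((∑ i, (r i : ℝ) * ξ i : ℝ) * I) ∂μ = C r) ∧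
      braggWeight μ ![Q] = 0 ∧ C 0 = ((M : ℂ) ^ d)⁻¹ ∧ (((M : ℝ) ^ d)⁻¹) ^ 2 ≤ Φ C := by
  -- the modulated functional is sound at `0` and range-`M` local
  set Φ₀ : ((Fin d → ℤ) → ℂ) → ℝ := fun C => Φ (fun r => exp ((((∑ i, (r i : ℝ) * Q i : ℝ)) : ℂ) * I) * C r) with hΦ₀
  have hsound₀ : ∀ (ν : Measure (EuclideanSpace ℝ (Fin d))) [IsFiniteMeasure ν] (C : (Fin d → ℤ) → ℂ),
      (∀ r : Fin d → ℤ, ∫ ξ, exp ((∑ i, (r i : ℝ) * ξ i : ℝ) * I) ∂ν = C r) →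
        braggWeight ν ![(0 : Fin d → ℝ)] ≤ Φ₀ C := by
    intro ν _ C hν
    have h := hsound (ν.map (fun ξ => ξ + WithLp.toLp 2 Q)) _ (fun r => represents_phase_of_map_add ν hν Q r)
    rwa [braggWeight_map_add] at h
  have hlocal₀ : ∀ C C' : (Fin d → ℤ) → ℂ, (∀ r : Fin d → ℤ, (∀ i, |r i| < M) → C r = C' r) → Φ₀ C = Φ₀ C' := by
    intro C C' hCC'
    exact hlocal _ _ fun r hr => by simp only [hCC' r hr]
  obtain ⟨μ₂, hfin, C₂, hμ₂, hb, h0, hΦ⟩ := exists_noODLRO_witness_of_boxLocal_ceiling M hd Φ₀ hsound₀ hlocal₀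
  refine ⟨μ₂.map (fun ξ => ξ + WithLp.toLp 2 Q), inferInstance,
    fun r => exp ((((∑ i, (r i : ℝ) * Q i : ℝ)) : ℂ) * I) * C₂ r, fun r => represents_phase_of_map_add μ₂ hμ₂ Q r,
    ?_, ?_, hΦ⟩
  · rw [braggWeight_map_add]; exact hb
  · simp [h0]

/-- **Néel-point form** (`d = 2`, `Q = (π,π)`): every sound, range-`M`-local ceiling on the antiferromagnetic Bragg weight is
`≥ C(0)/M²` on some represented lattice function with NO Néel weight — the box / diamond Néel ceilings of the controls menu are
footprint-limited like the pair-ODLRO ones. [cite: Scalapino1995, §2] -/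
theorem exists_noNeel_witness_of_boxLocal_ceiling (M : ℕ) [NeZero M] (Φ : ((Fin 2 → ℤ) → ℂ) → ℝ)
    (hsound : ∀ (μ : Measure (EuclideanSpace ℝ (Fin 2))) [IsFiniteMeasure μ] (C : (Fin 2 → ℤ) → ℂ),
      (∀ r : Fin 2 → ℤ, ∫ ξ, exp ((∑ i, (r i : ℝ) * ξ i : ℝ) * I) ∂μ = C r) → braggWeight μ ![![π, π]] ≤ Φ C)
    (hlocal : ∀ C C' : (Fin 2 → ℤ) → ℂ, (∀ r : Fin 2 → ℤ, (∀ i, |r i| < M) → C r = C' r) → Φ C = Φ C') :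
    ∃ (μ : Measure (EuclideanSpace ℝ (Fin 2))) (_ : IsFiniteMeasure μ) (C : (Fin 2 → ℤ) → ℂ),
      (∀ r : Fin 2 → ℤ, ∫ ξ, exp ((∑ i, (r i : ℝ) * ξ i : ℝ) * I) ∂μ = C r) ∧
      braggWeight μ ![![π, π]] = 0 ∧ C 0 = ((M : ℂ) ^ 2)⁻¹ ∧ (((M : ℝ) ^ 2)⁻¹) ^ 2 ≤ Φ C :=
  exists_noBragg_witness_of_boxLocal_ceiling_at M (by norm_num) ![π, π] Φ hsound hlocal

end Summit.Ventures.CertifiedManyBodySolver.Observables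

end
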